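import Summits.CriticalPhenomena.CardyFormulaZ2.Theses.CardyComplexCone
import Literature.Probability.LatticeModels.MedialInterfaceMeasurability
import HarnessLib

/-!
# Item `AEMeasurableInterfaceIn` of route `CardyComplexCone` (stmt-CriticalPhenomena-11269)

For every Dobrushin domain `D` and all discrete Dobrushin data `E`, the endpoint-oriented medial
exploration curve class `ω ↦ CurveClass.mk (orient (medialExplorationCurve E ω))` — the interface
map of `ParafermionToSLESixFamilies` / `SLESixFamiliesGiveCardy` at `E = Λ δ`, whose eventual
a.e.-measurability `ConvergesInLawToSLE` asks — is a.e.-measurable under critical bond percolation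
`bondPercolation (zdGraph 2) half`.

Proof: the map is a function of the medial exploration `medialExploration E ω`, and every such
function is measurable by the factorisation principle
`Literature.Probability.LatticeModels.measurable_of_medialExploration`
(`Literature/Probability/LatticeModels/MedialInterfaceMeasurability.lean`: the list type is
countable and each fibre is a countable Boolean combination of cylinder events). The hypotheses
`E.Ω = D.carrier` and `0 < E.δ` of the item are not needed, and measurability holds for any
measure. (Aizenman–Burchard, Duke Math. J. 99 (1999), §2.1; Smirnov, C. R. Acad. Sci. Paris 333
(2001), §2.)
-/

noncomputable section

open MeasureTheory
open Literature.Probability.LatticeModels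

namespace Summit.CriticalPhenomena.CardyFormulaZ2.Theorems

/-- **Item `AEMeasurableInterfaceIn` (stmt-CriticalPhenomena-11269), proved.** For every Dobrushin
domain `D` and all discrete Dobrushin data `E` (the hypotheses `E.Ω = D.carrier`, `0 < E.δ` are
not used), the endpoint-oriented medial exploration curve class
`ω ↦ CurveClass.mk (orient (medialExplorationCurve E ω))` is a.e.-measurable under
`bondPercolation (zdGraph 2) half` — in fact measurable under any measure, being a function of
`medialExploration E ω` (`measurable_of_medialExploration`).
(Aizenman–Burchard 1999, §2.1; Smirnov 2001, §2.) -/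
theorem aemeasurableInterfaceIn_proof :
    Summit.CriticalPhenomena.CardyFormulaZ2.Theses.CardyComplexCone.AEMeasurableInterfaceIn := by
  unfold Summit.CriticalPhenomena.CardyFormulaZ2.Theses.CardyComplexCone.AEMeasurableInterfaceIn
  intro D E _ _
  refine (measurable_of_medialExploration E fun ω ω' h => ?_).aemeasurable
  simp only [medialExplorationCurve_congr h]

end Summit.CriticalPhenomena.CardyFormulaZ2.Theorems

end
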